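import Literature.Probability.Percolation.ArmSeparationOutLanding
import Literature.Probability.Percolation.ArmSeparationOutFrames
import Literature.Probability.Percolation.ArmSeparationOutExt
import Literature.Probability.Percolation.ArmSeparationInScheme
import Literature.Probability.Percolation.ArmSeparationIntSeparation
import Literature.Probability.Percolation.ArmExponentsTwoArm
import HarnessLib

/-!
# Kesten's arm-separation theorem for two arms (Nolin 2008, Thm. 11): the discharge

Topic: Probability / Percolation; family `crit-perc` (`P = P_{1/2} = triSitePercolation half`).
The discharge of the named fact `Literature.Probability.Percolation.Nolin2008_twoArm_separation`
(`ArmSeparation.lean`; Nolin 2008, Thm. 11 [arXiv 0711.4948: Thm. 10], `j = 2`, `σ = BW`):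

`∃ c > 0, ∃ n₀, ∀ n ≥ n₀, ∀ N ≥ 2n, c · P(armEvent BW n N) ≤ P(sepTwoArm n N)`.

The proof is Nolin's (§4.4): the external extremities first, then the internal ones.

* `exists_real_armEvent_le_mul_extTwoArm` — **the external half**: the multi-scale summation of
  §4.4 (p. 12) on the exact doubling ladder `R_K = 2n · 2^K`, fed into the finite scheme
  `le_mul_of_separationScheme_upto` with the surgery step `real_armEvent_le_outStepFr` and the
  failure bound `real_not_outGoodFr_le` (`ArmSeparationOutFrames.lean`), the landing
  `real_outMidPair_le` of a rung (`ArmSeparationOutLanding.lean`; its constant made uniform in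
  `exists_ohland_const`), the outward extension `exists_real_extTwoArm_le_mul_outward`
  (`ArmSeparationOutExt.lean`) and the initial scale `exists_le_real_sepTwoArm_wide`; the scheme
  constants are those of `exists_scheme_constants` ("first `T`, then `K`").
* `Nolin2008_twoArm_separation_holds` — combined with the internal half
  `exists_extTwoArm_le_mul_sepTwoArm` (`ArmSeparationIntSeparation.lean`).

## References

* P. Nolin, *Near-critical percolation in two dimensions*, Electron. J. Probab. 13 (2008), §4.4,
  Thm. 11 and its proof [arXiv 0711.4948: Thm. 10, pp. 11–13]. [Nolin2008]
* H. Kesten, *Scaling relations for 2D-percolation*, Comm. Math. Phys. 109 (1987), Lemma 2. [Kesten1987]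
-/

noncomputable section

open Set MeasureTheory

namespace Literature.Probability.Percolation

open LatticeModels Tube

/-! ### The outer rung of half-radius `M` -/

/-- **The outer rung is valid** for `K ≥ 1`, `D ≥ 256 · 32^K`, `M ≥ 64 D`, `n ≤ M`. [folklore] -/
theorem orung_valid {M n D K : ℕ} (hK : 1 ≤ K) (hD : 256 * 32 ^ K ≤ D) (hM : 64 * D ≤ M) (hn : n ≤ M) :
    (⟨M, n, M / D, K, 8 * trapScale (M / D) K⟩ : OParams).Valid := by
  have hD1 : 1 ≤ D := by have h1 : 1 ≤ 32 ^ K := Nat.one_le_pow _ _ (by norm_num); omega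
  have hk : 64 ≤ M / D := (Nat.le_div_iff_mul_le (by omega)).2 (by linarith)
  have hμ : 256 * trapScale (M / D) K ≤ M := by
    unfold trapScale
    calc 256 * (M / D * 32 ^ K) = M / D * (256 * 32 ^ K) := by ring
      _ ≤ M / D * D := Nat.mul_le_mul_left _ hD
      _ ≤ M := Nat.div_mul_le_self M D
  exact
    { hk₀ := hk
      hK := hK
      hn := hn
      hμM := by show 64 * trapScale (M / D) K ≤ M; omega
      hR₀ := by show 8 * trapScale (M / D) K ≤ 8 * trapScale (M / D) K; exact le_rfl
      hR₀M := by show 4 * (8 * trapScale (M / D) K) ≤ M; omega }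

/-- Chunks per side of the white ring: `nW ≤ 3 D` (`D ≥ 256 · 32^K`, `M ≥ 64 D`). [folklore] -/
theorem orung_nW_le {M n D K : ℕ} (hD : 256 * 32 ^ K ≤ D) (hM : 64 * D ≤ M) :
    (⟨M, n, M / D, K, 8 * trapScale (M / D) K⟩ : OParams).nW ≤ 3 * D := by
  have hD1 : 1 ≤ D := by have h1 : 1 ≤ 32 ^ K := Nat.one_le_pow _ _ (by norm_num); omega
  have hk : 64 ≤ M / D := (Nat.le_div_iff_mul_le (by omega)).2 (by linarith)
  have hlt : M < D * (M / D) + D := by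
    have := Nat.lt_div_mul_add (a := M) hD1; linarith [Nat.mul_comm (M / D) D]
  have hμ : 256 * trapScale (M / D) K ≤ M := by
    unfold trapScale
    calc 256 * (M / D * 32 ^ K) = M / D * (256 * 32 ^ K) := by ring
      _ ≤ M / D * D := Nat.mul_le_mul_left _ hD
      _ ≤ M := Nat.div_mul_le_self M D
  show (M / D * ((2 * M + 3 * trapScale (M / D) K) / (M / D)) + M / D) / (M / D) ≤ 3 * D
  rw [show M / D * ((2 * M + 3 * trapScale (M / D) K) / (M / D)) + M / D =
      M / D * ((2 * M + 3 * trapScale (M / D) K) / (M / D) + 1) by ring, Nat.mul_div_cancel_left _ (by omega)]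
  have : (2 * M + 3 * trapScale (M / D) K) / (M / D) < 3 * D := by
    apply Nat.div_lt_of_lt_mul
    have h3 : M / D * (3 * D) = 3 * (D * (M / D)) := by ring
    rw [h3]; omega
  omega

/-- The number of windows is at most `10 D` (`M ≥ 64 D`, `D ≥ 1`). [folklore] -/
theorem orung_Nw_le {M n D K : ℕ} (hD1 : 1 ≤ D) (hM : 64 * D ≤ M) :
    (⟨M, n, M / D, K, 8 * trapScale (M / D) K⟩ : OParams).Nw ≤ 10 * D := by
  have hk : 64 ≤ M / D := (Nat.le_div_iff_mul_le (by omega)).2 (by linarith)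
  have hlt : M < D * (M / D) + D := by
    have := Nat.lt_div_mul_add (a := M) hD1; linarith [Nat.mul_comm (M / D) D]
  have hw : 16 ≤ M / D / 4 := by omega
  have hw' : M / D ≤ 4 * (M / D / 4) + 3 := by omega
  show 2 * M / (M / D / 4) + 1 ≤ 10 * D
  have h1 : D * (M / D) ≤ D * (4 * (M / D / 4) + 3) := Nat.mul_le_mul_left D hw'
  have h2 : D * 16 ≤ D * (M / D / 4) := Nat.mul_le_mul_left D hw
  have : 2 * M / (M / D / 4) < 9 * D := by
    apply Nat.div_lt_of_lt_mul
    have e1 : M / D / 4 * (9 * D) = 9 * (D * (M / D / 4)) := by ring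
    have e2 : D * (4 * (M / D / 4) + 3) = 4 * (D * (M / D / 4)) + 3 * D := by ring
    rw [e1]; rw [e2] at h1
    omega
  omega

/-- The spoke aspect condition of the outer rung: `LW + μ ≤ ρ · 2ε` with `ρ = 256 · 32^K`. [folklore] -/
theorem orung_aspect {M n D K : ℕ} (hD : 256 * 32 ^ K ≤ D) (hM : 64 * D ≤ M) :
    (⟨M, n, M / D, K, 8 * trapScale (M / D) K⟩ : OParams).LW + (⟨M, n, M / D, K, 8 * trapScale (M / D) K⟩ : OParams).μ ≤
      256 * 32 ^ K * (2 * (⟨M, n, M / D, K, 8 * trapScale (M / D) K⟩ : OParams).ε) := by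
  have hD1 : 1 ≤ D := by have h1 : 1 ≤ 32 ^ K := Nat.one_le_pow _ _ (by norm_num); omega
  have hk : 64 ≤ M / D := (Nat.le_div_iff_mul_le (by omega)).2 (by linarith)
  have hX : 1 ≤ 32 ^ K := Nat.one_le_pow _ _ (by norm_num)
  show 3 * trapScale (M / D) K + 2 * (M / D) + 4 * (M / D / 4) + trapScale (M / D) K ≤ 256 * 32 ^ K * (2 * (M / D / 16))
  unfold trapScale
  have hq : 7 * (M / D) ≤ 512 * (M / D / 16) := by omega
  have h4 : 4 * (M / D / 4) ≤ M / D := Nat.mul_div_le _ _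
  have hkX : M / D ≤ M / D * 32 ^ K := Nat.le_mul_of_pos_right _ hX
  calc 3 * (M / D * 32 ^ K) + 2 * (M / D) + 4 * (M / D / 4) + M / D * 32 ^ K ≤ 7 * (M / D) * 32 ^ K := by
        linarith [h4, hkX, Nat.mul_assoc 7 (M / D) (32 ^ K)]
    _ ≤ 512 * (M / D / 16) * 32 ^ K := Nat.mul_le_mul_right _ hq
    _ = 256 * 32 ^ K * (2 * (M / D / 16)) := by ring

/-- **The outer landing inequality with a constant depending on `D, K` only**: for `K ≥ 1`,
`D ≥ 256 · 32^K` there is `C₁` with `P(OutMidPair ⟨M, n, M/D, K, 8μ⟩) ≤ C₁ · P(extTwoArm n (4M))`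
for all `M ≥ 64 D`, `n ≤ M`. [cite: Nolin2008, §4.4 (arXiv 0711.4948: proof of Thm. 10, p. 12, the constant `C₁(η') C₂(η')`)] -/
theorem exists_ohland_const (D K : ℕ) (hK : 1 ≤ K) (hD : 256 * 32 ^ K ≤ D) :
    ∃ C₁ : ℝ, 0 ≤ C₁ ∧ ∀ M n : ℕ, 64 * D ≤ M → n ≤ M →
      (triSitePercolation half).real (OutMidPair (⟨M, n, M / D, K, 8 * trapScale (M / D) K⟩ : OParams)) ≤
        C₁ * (triSitePercolation half).real (extTwoArm n (4 * M)) := by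
  obtain ⟨cF, hcF, hF⟩ := exists_pos_le_real_triFrameAt
  obtain ⟨c, hc, hrsw⟩ := tri_rsw_half_holds ((256 * 32 ^ K : ℕ) : ℝ) (by positivity)
  have hrsw' : ∀ q : ℕ, 1 ≤ ⌊((256 * 32 ^ K : ℕ) : ℝ) * q⌋₊ → c ≤ triLRCrossingProb half ⌊((256 * 32 ^ K : ℕ) : ℝ) * q⌋₊ q :=
    fun q hq => (hrsw q hq).1
  have hX : 1 ≤ 32 ^ K := Nat.one_le_pow _ _ (by norm_num)
  have hρ64 : 64 ≤ 256 * 32 ^ K := by omega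
  have hc1 : c ≤ 1 := (hrsw' 1 (by rw [Nat.cast_one, mul_one, Nat.floor_natCast]; omega)).trans measureReal_le_one
  set q : ℝ := (cF * c ^ (36 * D + 3)) ^ 2 with hq
  have hq0 : 0 < q := by positivity
  refine ⟨(36 * K ^ 2 * (10 * D) ^ 2 : ℕ) / q, by positivity, fun M n hM hn => ?_⟩
  set P : OParams := ⟨M, n, M / D, K, 8 * trapScale (M / D) K⟩ with hP
  have hD1 : 1 ≤ D := by omega
  have hV : P.Valid := orung_valid hK hD hM hn
  have key := real_outMidPair_le hV hF hrsw' hc.le hcF.le hρ64 (orung_aspect (n := n) hD hM)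
  have hnW := orung_nW_le (n := n) (K := K) hD hM
  have hNw := orung_Nw_le (n := n) (K := K) hD1 hM
  rw [← hP] at hnW hNw
  -- the slot constant is at least `q`
  have hqq : q ≤ (cF * c ^ (12 * P.nW + 3)) ^ 2 := by
    rw [hq]
    apply pow_le_pow_left₀ (by positivity)
    exact mul_le_mul_of_nonneg_left (pow_le_pow_of_le_one hc.le hc1 (by omega)) hcF.le
  have h1 : (triSitePercolation half).real (OutMidPair P) * q ≤
      (36 * P.K ^ 2 * P.Nw ^ 2 : ℕ) * (triSitePercolation half).real (extTwoArm P.n (4 * P.M)) :=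
    (mul_le_mul_of_nonneg_left hqq measureReal_nonneg).trans key
  have h2 : ((36 * P.K ^ 2 * P.Nw ^ 2 : ℕ) : ℝ) ≤ (36 * K ^ 2 * (10 * D) ^ 2 : ℕ) := by
    have : P.K = K := rfl
    rw [this]
    exact_mod_cast Nat.mul_le_mul_left _ (Nat.pow_le_pow_left hNw 2)
  rw [div_mul_eq_mul_div, le_div_iff₀ hq0]
  calc (triSitePercolation half).real (OutMidPair P) * q
      ≤ (36 * P.K ^ 2 * P.Nw ^ 2 : ℕ) * (triSitePercolation half).real (extTwoArm P.n (4 * P.M)) := h1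
    _ ≤ (36 * K ^ 2 * (10 * D) ^ 2 : ℕ) * (triSitePercolation half).real (extTwoArm n (4 * M)) :=
        mul_le_mul_of_nonneg_right h2 measureReal_nonneg

/-- **Guards of the outer rung**: with `D = 256 · 32^(K + K_g)` and `M ≥ 64 D`, the side
conditions of the surgery step and of the failure bound hold with `R = R_g = M - 1`. [folklore] -/
theorem orung_guards {K Kg D M : ℕ} (hD : D = 256 * 32 ^ (K + Kg)) (hM : 64 * D ≤ M) :
    (∀ j < K, 2 * trapScale (M / D) j + 1 ≤ M - 1) ∧ (∀ i < Kg, 16 * trapScale (8 * trapScale (M / D) K) i ≤ M - 1) ∧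
      (∀ j < K, 16 * (trapScale (M / D) j : ℤ) + 1 ≤ M) ∧ 1 ≤ M / D ∧ 3 ≤ M := by
  have hX : 1 ≤ 32 ^ (K + Kg) := Nat.one_le_pow _ _ (by norm_num)
  have hD1 : 1 ≤ D := by rw [hD]; omega
  have hk : 64 ≤ M / D := (Nat.le_div_iff_mul_le (by omega)).2 (by linarith)
  have hμ : 256 * trapScale (M / D) (K + Kg) ≤ M := by
    unfold trapScale
    calc 256 * (M / D * 32 ^ (K + Kg)) = M / D * (256 * 32 ^ (K + Kg)) := by ring
      _ = M / D * D := by rw [hD]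
      _ ≤ M := Nat.div_mul_le_self M D
  have hstep : ∀ j, trapScale (M / D) j ≤ trapScale (M / D) (j + 1) := fun j => by rw [trapScale_succ]; omega
  have hjK : ∀ j < K, trapScale (M / D) j ≤ trapScale (M / D) (K + Kg) := fun j hj =>
    (hstep j).trans (trapScale_mono _ (by omega : j < K + Kg))
  refine ⟨fun j hj => ?_, fun i hi => ?_, fun j hj => ?_, by omega, by omega⟩
  · have := hjK j hj; omega
  · have h1 : trapScale (8 * trapScale (M / D) K) i = 8 * trapScale (M / D) (K + i) := by
      unfold trapScale; rw [pow_add]; ring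
    have h2 : trapScale (M / D) (K + i) ≤ trapScale (M / D) (K + Kg) :=
      (hstep (K + i)).trans (trapScale_mono _ (by omega : K + i < K + Kg))
    rw [h1]; omega
  · have := hjK j hj
    have : 16 * trapScale (M / D) j + 1 ≤ M := by omega
    exact_mod_cast this

/-! ### The external half -/

/-- **The external half of the arm-separation theorem**: there are `C > 0` and `n₀` with
`P(armEvent BW n N) ≤ C · P(extTwoArm n N)` for all `n ≥ n₀`, `N ≥ 2n` — two arms crossing the
annulus can be required to land `N/64`-separated on the two sides of `∂Λ_N` at constant cost.
Nolin's induction of §4.4 on the external extremities, on the exact doubling ladder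
`R_K = 2n · 2^K`. [cite: Nolin2008, §4.4 Thm. 11 (arXiv 0711.4948: Thm. 10, pp. 11–13), external extremities; Kesten1987, Lemma 2] -/
theorem exists_real_armEvent_le_mul_extTwoArm :
    ∃ C : ℝ, 0 < C ∧ ∃ n₀ : ℕ, ∀ n N : ℕ, n₀ ≤ n → 2 * n ≤ N →
      (triSitePercolation half).real (armEvent ![true, false] n N) ≤ C * (triSitePercolation half).real (extTwoArm n N) := by
  -- the constants
  obtain ⟨C₀, hC₀, hout⟩ := exists_real_extTwoArm_le_mul_outward
  obtain ⟨ci, hci, hinit⟩ := exists_le_real_sepTwoArm_wide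
  obtain ⟨cF, hcF, hF⟩ := exists_pos_le_real_triFrameAt
  obtain ⟨c4, hc4, hrsw4⟩ := tri_rsw_half_holds 4 (by norm_num)
  have hrsw4' : ∀ q : ℕ, 1 ≤ ⌊(4 : ℝ) * q⌋₊ → c4 ≤ triLRCrossingProb half ⌊(4 : ℝ) * q⌋₊ q := fun q hq => (hrsw4 q hq).1
  have hc4le : c4 ≤ 1 := (hrsw4' 1 (by norm_num)).trans measureReal_le_one
  have hcFle : cF ≤ 1 := (hF 0 1 le_rfl).trans measureReal_le_one
  set a : ℝ := 1 - c4 with ha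
  set b : ℝ := 1 - cF ^ 2 with hb
  have ha0 : 0 ≤ a := by rw [ha]; linarith
  have ha1 : a < 1 := by rw [ha]; linarith
  have hb0 : 0 ≤ b := by rw [hb]; linarith [pow_le_one₀ hcF.le hcFle (n := 2)]
  have hb1 : b < 1 := by rw [hb]; linarith [pow_pos hcF 2]
  have hC₀0 : 0 < C₀ := lt_of_lt_of_le one_pos hC₀
  obtain ⟨T, K, Kg, hK1, hsmall⟩ := exists_scheme_constants ha0 ha1 hb0 hb1 hC₀
  set ε : ℝ := 12 * (a ^ (T + 1) + T * b ^ K + 2 * b ^ Kg) with hε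
  have hε0 : 0 ≤ ε := by positivity
  have hεC : ε * C₀ ^ 2 ≤ 1 / 2 := by rw [hε]; exact hsmall
  set D : ℕ := 256 * 32 ^ (K + Kg) with hD
  have hDK : 256 * 32 ^ K ≤ D := by
    rw [hD, pow_add]; exact Nat.mul_le_mul_left _ (Nat.le_mul_of_pos_right _ (Nat.one_le_pow _ _ (by norm_num)))
  have hD1 : 1 ≤ D := le_trans (Nat.one_le_pow K 32 (by norm_num)) (le_trans (Nat.le_mul_of_pos_left _ (by norm_num)) hDK)
  obtain ⟨C₁, hC₁, hland⟩ := exists_ohland_const D K hK1 hDK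
  -- the statement
  set Cs : ℝ := 2 * C₁ + 1 / ci with hCs
  have hCs0 : 0 < Cs := by positivity
  refine ⟨Cs * C₀ + 1 / ci, by positivity, 32 * D + 1100, fun n N hn hN => ?_⟩
  have hn1100 : 1100 ≤ n := le_trans (Nat.le_add_left _ _) hn
  have hnD : 32 * D ≤ n := le_trans (Nat.le_add_right _ _) hn
  set μ := triSitePercolation half with hμ
  have hP1 : ∀ s : Set (SiteConfig (Site 2)), μ.real s ≤ 1 := fun s => measureReal_le_one
  have hP0 : ∀ s : Set (SiteConfig (Site 2)), 0 ≤ μ.real s := fun s => measureReal_nonneg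
  have hsepext : ∀ R, 2 * n ≤ R → μ.real (sepTwoArm n R) ≤ μ.real (extTwoArm n R) := fun R hR =>
    measureReal_mono (sepTwoArm_subset_extTwoArm hR) (measure_ne_top _ _)
  -- small `N`: the initial estimate alone
  by_cases hsmallN : N < 8 * n
  · have h1 : ci ≤ μ.real (extTwoArm n N) := (hinit n N hn1100 hN (by omega)).trans (hsepext N hN)
    have h2 : 1 ≤ 1 / ci * μ.real (extTwoArm n N) := by
      rw [one_div, inv_mul_eq_div, le_div_iff₀ hci]; linarith
    calc μ.real (armEvent ![true, false] n N) ≤ 1 := hP1 _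
      _ ≤ 1 / ci * μ.real (extTwoArm n N) := h2
      _ ≤ (Cs * C₀ + 1 / ci) * μ.real (extTwoArm n N) := by
          have := hP0 (extTwoArm n N); have : 0 ≤ Cs * C₀ := by positivity
          nlinarith
  push Not at hsmallN
  -- the ladder `ρ K' = 2n · 2^K'` and its top `L ≥ 1` with `2 ρ L ≤ N < 4 ρ L`
  set ρ : ℕ → ℕ := fun K' => 2 * n * 2 ^ K' with hρ
  have hρsucc : ∀ K', ρ (K' + 1) = 2 * ρ K' := fun K' => by simp only [hρ, pow_succ]; ring
  have hρn : ∀ K', 2 * n ≤ ρ K' := fun K' => by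
    simp only [hρ]; exact Nat.le_mul_of_pos_right _ (Nat.one_le_two_pow)
  have hρmono : ∀ K', ρ K' ≤ ρ (K' + 1) := fun K' => by rw [hρsucc]; omega
  have hex : ∃ j, N < 2 * ρ (j + 1) := by
    refine ⟨N, ?_⟩
    simp only [hρ]
    have h2 : N + 1 < 2 ^ (N + 1) := Nat.lt_two_pow_self
    have h3 : 1 ≤ 2 * n := by omega
    calc N < 2 ^ (N + 1) := by omega
      _ ≤ 2 * n * 2 ^ (N + 1) := Nat.le_mul_of_pos_left _ h3
      _ ≤ 2 * (2 * n * 2 ^ (N + 1)) := Nat.le_mul_of_pos_left _ (by norm_num)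
  classical
  set L := Nat.find hex with hL
  have hLspec : N < 2 * ρ (L + 1) := Nat.find_spec hex
  have hL1 : 1 ≤ L := by
    by_contra h
    have hL0 : L = 0 := by omega
    rw [hL0, zero_add] at hLspec
    simp only [hρ, pow_one] at hLspec
    omega
  have hLle : 2 * ρ L ≤ N := by
    have := Nat.find_min hex (show L - 1 < L by omega)
    rw [show L - 1 + 1 = L by omega] at this
    omega
  have hρLN : ρ L ≤ N := by omega
  have hNρ : N ≤ 32 * ρ L := by rw [hρsucc] at hLspec; omega
  -- the three sequences
  set oP : ℕ → OParams := fun M => ⟨M, n, M / D, K, 8 * trapScale (M / D) K⟩ with hoP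
  set f : ℕ → ℝ := fun K' => μ.real (armEvent ![true, false] n (ρ K')) with hf
  set g : ℕ → ℝ := fun K' => μ.real (OutMidPair (oP (ρ (K' - 1)))) with hg
  set h : ℕ → ℝ := fun K' => μ.real (extTwoArm n (ρ K')) with hh
  have key := le_mul_of_separationScheme_upto (f := f) (g := g) (h := h) (k := 0) (L := L) hε0 hC₀ hC₁ hci hεC
    (fun K' => hP1 _) (fun K' => hP0 _) (by omega)
    (fun K' _ _ => measureReal_mono (armEvent_mono_holds _ (by have := hρn K'; omega) (hρmono K')) (measure_ne_top _ _))
    (fun K' _ _ => by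
      -- the surgery step at half-radius `M = ρ K'`, `2M = ρ (K'+1)`
      have hM : 64 * D ≤ ρ K' := by have := hρn K'; omega
      obtain ⟨gR, gRg, gKM, gk₀, gM3⟩ := orung_guards (K := K) (Kg := Kg) hD hM
      have hnM : n ≤ ρ K' := by have := hρn K'; omega
      have hR₀ : 1 ≤ 8 * trapScale (ρ K' / D) K := by
        have := le_trapScale (ρ K' / D) K; omega
      have step := real_armEvent_le_outStepFr (T := T) (Kg := Kg) (R := ρ K' - 1) (Rg := ρ K' - 1) (by omega) hnM hR₀ gR
        (by omega) gRg (by omega)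
      have bad := real_not_outGoodFr_le (T := T) (K := K) (Kg := Kg) (R₀ := 8 * trapScale (ρ K' / D) K) hcF hF hrsw4' gM3 gk₀ hR₀ gKM
      rw [← ha, ← hb] at bad
      have hbad' : μ.real {ω | ¬ OutGoodFr (ρ K') T (ρ K' / D) K (8 * trapScale (ρ K' / D) K) Kg ω} ≤ ε := by rw [hε]; exact bad
      have htiny : μ.real (OutMidTiny (ρ K') n (ρ K' / D) K (8 * trapScale (ρ K' / D) K)) ≤ g (K' + 1) := by
        simp only [hg, Nat.add_sub_cancel]
        -- `OutMidTiny M n k₀ K R₀` is definitionally `OutMidPair ⟨M, n, k₀, K, R₀⟩` (`GoodTip` unfolds to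
        -- the two tip-height inequalities), so the inclusion is `Subset.rfl`.
        exact measureReal_mono Subset.rfl (measure_ne_top _ _)
      have hfK : 0 ≤ f K' := hP0 _
      have hbf := mul_le_mul_of_nonneg_right hbad' hfK
      show μ.real (armEvent ![true, false] n (ρ (K' + 1))) ≤ g (K' + 1) + ε * μ.real (armEvent ![true, false] n (ρ K'))
      rw [hρsucc]
      linarith [step, htiny, hbf])
    (fun K' hK' _ => by
      -- the landing inequality at half-radius `ρ (K'-1)`: `4 ρ (K'-1) = ρ (K'+1)`
      have hM : 64 * D ≤ ρ (K' - 1) := by have := hρn (K' - 1); omega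
      have h1 := hland (ρ (K' - 1)) n hM (by have := hρn (K' - 1); omega)
      have h4 : 4 * ρ (K' - 1) = ρ (K' + 1) := by
        rw [show K' + 1 = (K' - 1) + 1 + 1 by omega, hρsucc, hρsucc]; ring
      show μ.real (OutMidPair (oP (ρ (K' - 1)))) ≤ C₁ * μ.real (extTwoArm n (ρ (K' + 1)))
      rw [← h4]; exact h1)
    (fun K' hK' _ => by
      -- the outward extension from `ρ K'` to `ρ (K'+1) = 2 ρ K'`
      have h2200 : 2200 ≤ ρ K' := by have := hρn K'; omega
      have h1 := hout n (ρ K') (ρ (K' + 1)) h2200 (hρn K') (by rw [hρsucc]) (by rw [hρsucc]; omega)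
      exact h1)
    (by
      -- the initial estimate at `ρ 1 = 4n`
      show ci ≤ μ.real (extTwoArm n (ρ (0 + 1)))
      have hρ1 : ρ (0 + 1) = 4 * n := by simp only [hρ, zero_add, pow_one]; ring
      rw [hρ1]
      exact (hinit n (4 * n) hn1100 (by omega) (by omega)).trans (hsepext _ (by omega)))
    L hL1 le_rfl
  simp only [hf, hh] at key
  -- from `ρ L` to `N`
  have h2200 : 2200 ≤ ρ L := by have := hρn L; omega
  have e1 : μ.real (armEvent ![true, false] n N) ≤ μ.real (armEvent ![true, false] n (ρ L)) :=
    measureReal_mono (armEvent_mono_holds _ (by have := hρn L; omega) hρLN) (measure_ne_top _ _)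
  have e2 := hout n (ρ L) N h2200 (hρn L) hLle hNρ
  have e3 : 0 ≤ μ.real (extTwoArm n N) := hP0 _
  calc μ.real (armEvent ![true, false] n N) ≤ Cs * μ.real (extTwoArm n (ρ L)) := e1.trans key
    _ ≤ Cs * (C₀ * μ.real (extTwoArm n N)) := mul_le_mul_of_nonneg_left e2 hCs0.le
    _ ≤ (Cs * C₀ + 1 / ci) * μ.real (extTwoArm n N) := by
        have : 0 ≤ 1 / ci * μ.real (extTwoArm n N) := by positivity
        nlinarith

/-! ### The theorem -/

/-- **Kesten's arm-separation theorem for two arms at `p = 1/2`** (Nolin 2008, Thm. 11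
[arXiv 0711.4948: Thm. 10], `j = 2`, `σ = BW`): the named fact
`Nolin2008_twoArm_separation` holds — `∃ c > 0, ∃ n₀, ∀ n ≥ n₀, ∀ N ≥ 2n,
c · P(armEvent BW n N) ≤ P(sepTwoArm n N)`. The external half
(`exists_real_armEvent_le_mul_extTwoArm`) followed by the internal half
(`exists_extTwoArm_le_mul_sepTwoArm`). [cite: Nolin2008, §4.4 Thm. 11 (arXiv 0711.4948: Thm. 10); Kesten1987, Lemma 2] -/
theorem Nolin2008_twoArm_separation_holds : Nolin2008_twoArm_separation := by
  obtain ⟨CE, hCE, nE, hE⟩ := exists_real_armEvent_le_mul_extTwoArm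
  obtain ⟨CI, hCI, nI, hI⟩ := exists_extTwoArm_le_mul_sepTwoArm
  refine ⟨1 / (CE * CI), by positivity, max nE nI, fun n N hn hN => ?_⟩
  have h1 := hE n N (le_trans (le_max_left _ _) hn) hN
  have h2 := hI n N (le_trans (le_max_right _ _) hn) hN
  have h3 : (triSitePercolation half).real (armEvent ![true, false] n N) ≤
      CE * CI * (triSitePercolation half).real (sepTwoArm n N) := by
    calc (triSitePercolation half).real (armEvent ![true, false] n N)
        ≤ CE * (triSitePercolation half).real (extTwoArm n N) := h1
      _ ≤ CE * (CI * (triSitePercolation half).real (sepTwoArm n N)) := mul_le_mul_of_nonneg_left h2 hCE.le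
      _ = CE * CI * (triSitePercolation half).real (sepTwoArm n N) := by ring
  show 1 / (CE * CI) * polyArmProb ![true, false] n N ≤ (triSitePercolation half).real (sepTwoArm n N)
  unfold polyArmProb
  rw [one_div, inv_mul_eq_div, div_le_iff₀ (by positivity)]
  linarith [h3]

end Literature.Probability.Percolation
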